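import Literature.NumberTheory.Automorphic.ArchRankOneLimitFormulaPartial     -- ★ p841213 (R3-c) step 1: the iterated currency `∫ k ∂μ₀, ∫ o ∂Measure.pi μ'`, §4 orbit measures (`integral_map_conj_circleDiagonal`)
import Mathlib.MeasureTheory.Measure.Dirac
import HarnessLib

/-!
# One place in, one place out: `∫ F d(⊗_w μ_w[w₀ ↦ ν]) = ∫_{x∼ν} ∫_{o∼⊗_{w′≠w₀} μ_{w′}} F(e⁻¹(x, o))` — Fubini at a distinguished coordinate for ARBITRARY σ-finite families, with the Dirac and
# orbit-measure specialisations (the repackaging step of the descent over places in Lemma 14.5.2 (c) at `∞`; Rogawski 1990 §8.3, Borel–Jacquet §4.1)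

Topic `NumberTheory/Automorphic`; namespace `Literature.NumberTheory.Automorphic.UnitaryGroup`.  THEOREMS ONLY (no `def`, no instance, no notation, no axiom, no named fact, no `sorry`).
Cell `pub/hodgecm-mathlib`, ENGINE T1 (crux H413 = `stmt-HodgeConjecture-24833`); ROAD-Sd residual R3 «(S-c) central vanishing» (`stub_ScCore` of `Cruxes/H413/Lines/F0_P3a_SdArch.lean`), brick
(R3-f) step 2a; author F0P3a-p02 (g10), 2026-09-01.

WHY.  The descent IH(S) ⇒ IH(S ∖ w₁) of (S-c) (census (M1); bus 2026-09-01T04:57Z) keeps ONE test function `Θ` on `∏_w G_w` and a FULL family of per-place measures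
`μ = (μ_w)_w` — orbit measures at the places of `S`, Dirac masses at `z_w•1` off `S` — and at each step must (i) pull the moving place `w₁` OUT of `⊗_w μ_w` into the iterated currency
`∫_{k∼Haar} ∫_{o∼⊗_{w′≠w₁}μ_{w′}} Θ(e⁻¹(k·t·k⁻¹, o))` of ★ (R1G)∘(R1-a) (`ArchRankOneLimitFormulaPartial` §1), and (ii) push the limit value `∫ Θ(e⁻¹(z•1, o)) d(⊗_{w′≠w₁}μ_{w′})` BACK as the
full-family integral with the Dirac mass at `w₁`.  Both are Fubini at one coordinate for the updated family `μ[w₁ ↦ ν]` (Mathlib `measurePreserving_piEquivPiSubtypeProd` ∕ `…_piUnique`, the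
pattern of ★ (V7) (h2)′), which this file states once, GENERICALLY in the index type, and then in the `archLocal` dress with ★ (R1-a)'s assembled family `e⁻¹(x, o)` TOKEN-IDENTICAL.

WHAT IS PROVED.
§1 (generic finite product `∀ i, X i`, `DecidableEq ι`): `sigmaFinite_update`, `isFiniteMeasureOnCompacts_update` (updated families stay σ-finite ∕ Radon coordinatewise), `pi_update_restrict_eq`
   (off `i₀` the updated family is the old one), **`integral_pi_update_eq_integral_integral`** — `∫ F ∂⊗(μ[i₀ ↦ ν]) = ∫ x ∂ν, ∫ o ∂⊗_{i≠i₀} μ_i, F (e⁻¹(x, o))` for `F` integrable,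
   **`integral_pi_update_dirac`** (`ν = δ_{x₀}`: `= ∫ o, F (e⁻¹(x₀, o)) ∂⊗_{i≠i₀} μ_i`), `stronglyMeasurable_integral_assemble` (the slice `x ↦ ∫ o, F(e⁻¹(x, o))` is strongly measurable),
   **`integral_pi_update_map`** (`ν = φ_* ν₀`, `φ` measurable: `= ∫ k ∂ν₀, ∫ o, F (e⁻¹(φ k, o))`).
§2 (`X w = archLocal L N (diag α) w`, places of a CM field): the same three identities restated with ★ (R1-a)'s binder texts, and the orbit-measure case
   **`integral_pi_update_map_conj_circleDiagonal`** (`ν = conj(diag u)_* ν₀`: `= ∫ k ∂ν₀, ∫ o, F (e⁻¹(k·diag(u)·k⁻¹, o))` — the left side of ★ `exists_tendsto_deriv_two_sin_smul_integral_integral_insert`).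
HONEST LABEL: HC_CM is proved only modulo the 7 printed citations until rung 0 closes; this file is measure plumbing and pays nothing by itself.

## References
* [Rogawski1990] J. D. Rogawski, *Automorphic Representations of Unitary Groups in Three Variables*, Ann. of Math. Stud. 123 (1990), §8.3 p. 122; §14.5 Lemma 14.5.2 (c) p. 238.
* [BorelJacquet1979] A. Borel, H. Jacquet, *Automorphic forms and automorphic representations*, PSPM 33.1 (1979), §4.1 (`G_∞ = ∏_v G_v`, product measures).
* [DeitmarEchterhoff2014] A. Deitmar, S. Echterhoff, *Principles of Harmonic Analysis*, 2nd ed. (2014), Thm. 1.5.3 (Fubini in the form used).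
-/

set_option autoImplicit false

noncomputable section

open MeasureTheory Matrix NumberField NumberField.InfinitePlace Set Function Filter Topology
open scoped MatrixGroups

namespace Literature.NumberTheory.Automorphic.UnitaryGroup

/-! ## §1 Generic finite products: one coordinate in, one coordinate out -/

section Generic

variable {ι : Type*} [DecidableEq ι] {X : ι → Type*} [∀ i, MeasurableSpace (X i)]

/-- An updated family of σ-finite measures is σ-finite coordinatewise. [cite: DeitmarEchterhoff2014, Thm. 1.5.3] -/
theorem sigmaFinite_update (μ : ∀ i, Measure (X i)) [∀ i, SigmaFinite (μ i)] (i₀ : ι) (ν : Measure (X i₀)) [SigmaFinite ν] :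
    ∀ i, SigmaFinite (Function.update μ i₀ ν i) := by
  intro i
  by_cases h : i = i₀
  · subst h
    rw [Function.update_self]
    infer_instance
  · rw [Function.update_of_ne h]
    infer_instance

/-- An updated family of Radon measures is Radon coordinatewise. [cite: DeitmarEchterhoff2014, Thm. 1.5.3] -/
theorem isFiniteMeasureOnCompacts_update [∀ i, TopologicalSpace (X i)] (μ : ∀ i, Measure (X i)) [∀ i, IsFiniteMeasureOnCompacts (μ i)] (i₀ : ι)
    (ν : Measure (X i₀)) [IsFiniteMeasureOnCompacts ν] :
    ∀ i, IsFiniteMeasureOnCompacts (Function.update μ i₀ ν i) := by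
  intro i
  by_cases h : i = i₀
  · subst h
    rw [Function.update_self]
    infer_instance
  · rw [Function.update_of_ne h]
    infer_instance

/-- Off the updated coordinate the family is unchanged: `(μ[i₀ ↦ ν])|_{i ≠ i₀} = μ|_{i ≠ i₀}`. [cite: DeitmarEchterhoff2014, Thm. 1.5.3] -/
theorem pi_update_restrict_eq (μ : ∀ i, Measure (X i)) (i₀ : ι) (ν : Measure (X i₀)) :
    (fun i : {i // ¬ i = i₀} => Function.update μ i₀ ν i.1) = fun i : {i // ¬ i = i₀} => μ i.1 :=
  funext fun i => Function.update_of_ne i.2 _ _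

variable [Fintype ι]

/-- **ONE COORDINATE IN, ONE COORDINATE OUT (Fubini at `i₀` for an updated family)**: for σ-finite `μ_i`, `ν` and `F` integrable against `⊗(μ[i₀ ↦ ν])`,
`∫ F ∂⊗(μ[i₀ ↦ ν]) = ∫ x ∂ν, ∫ o ∂⊗_{i ≠ i₀} μ_i, F(e⁻¹(x, o))`, `e⁻¹(x, o)` the assembled family (Mathlib `piEquivPiSubtypeProd` ∕ `piUnique`, the tokens of ★ (V7) ∕ ★ (R1-a)).
[cite: DeitmarEchterhoff2014, Thm. 1.5.3] [cite: BorelJacquet1979, §4.1] -/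
theorem integral_pi_update_eq_integral_integral {E : Type*} [NormedAddCommGroup E] [NormedSpace ℝ E]
    (μ : ∀ i, Measure (X i)) [∀ i, SigmaFinite (μ i)] (i₀ : ι) (ν : Measure (X i₀)) [SigmaFinite ν]
    (F : (∀ i, X i) → E) (hF : Integrable F (Measure.pi (Function.update μ i₀ ν))) :
    ∫ y, F y ∂(Measure.pi (Function.update μ i₀ ν)) =
      ∫ x, ∫ o, F ((MeasurableEquiv.piEquivPiSubtypeProd X (· = i₀)).symm ((MeasurableEquiv.piUnique fun i : {i // i = i₀} => X i.1).symm x, o))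
        ∂(Measure.pi fun i : {i // ¬ i = i₀} => μ i.1) ∂ν := by
  haveI : ∀ i, SigmaFinite (Function.update μ i₀ ν i) := sigmaFinite_update μ i₀ ν
  have hψ := measurePreserving_piEquivPiSubtypeProd (fun i => Function.update μ i₀ ν i) (· = i₀)
  have h2 := (hψ.symm.integral_comp' F).symm
  have hFi : Integrable (fun q => F ((MeasurableEquiv.piEquivPiSubtypeProd X (· = i₀)).symm q)) _ :=
    (hψ.symm.integrable_comp_emb (MeasurableEquiv.measurableEmbedding _)).mpr hF
  rw [show (∫ y, F y ∂(Measure.pi (Function.update μ i₀ ν))) = ∫ y, F y ∂(Measure.pi fun i => Function.update μ i₀ ν i) from rfl, h2,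
    integral_prod _ hFi, pi_update_restrict_eq μ i₀ ν]
  have hu : MeasurePreserving (MeasurableEquiv.piUnique fun i : {i // i = i₀} => X i.1)
      (@Measure.pi {i // i = i₀} (fun i => X i.1) (Subtype.fintype fun x => x = i₀) (fun i => inferInstance) (fun i => Function.update μ i₀ ν i.1))
      (Function.update μ i₀ ν i₀) := by
    convert measurePreserving_piUnique (fun i : {i // i = i₀} => Function.update μ i₀ ν i.1) <;>
      exact ((default : {i // i = i₀}).2).symm
  rw [Function.update_self] at hu
  rw [← hu.symm.integral_comp']
  rfl

/-- **The Dirac case**: `∫ F ∂⊗(μ[i₀ ↦ δ_{x₀}]) = ∫ o, F(e⁻¹(x₀, o)) ∂⊗_{i ≠ i₀} μ_i` (a coordinate frozen at a point; in (S-c) a place already taken to the centre `z_w•1`).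
[cite: DeitmarEchterhoff2014, Thm. 1.5.3] [cite: Rogawski1990, §14.5 p. 238] -/
theorem integral_pi_update_dirac {E : Type*} [NormedAddCommGroup E] [NormedSpace ℝ E] [CompleteSpace E]
    (μ : ∀ i, Measure (X i)) [∀ i, SigmaFinite (μ i)] (i₀ : ι) [MeasurableSingletonClass (X i₀)] (x₀ : X i₀)
    (F : (∀ i, X i) → E) (hF : Integrable F (Measure.pi (Function.update μ i₀ (Measure.dirac x₀)))) :
    ∫ y, F y ∂(Measure.pi (Function.update μ i₀ (Measure.dirac x₀))) =
      ∫ o, F ((MeasurableEquiv.piEquivPiSubtypeProd X (· = i₀)).symm ((MeasurableEquiv.piUnique fun i : {i // i = i₀} => X i.1).symm x₀, o))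
        ∂(Measure.pi fun i : {i // ¬ i = i₀} => μ i.1) := by
  rw [integral_pi_update_eq_integral_integral μ i₀ (Measure.dirac x₀) F hF, integral_dirac]

/-- The slice `x ↦ ∫ o, F(e⁻¹(x, o)) ∂⊗_{i ≠ i₀} μ_i` of a strongly measurable `F` is strongly measurable (Fubini measurability). [cite: DeitmarEchterhoff2014, Thm. 1.5.3] -/
theorem stronglyMeasurable_integral_assemble {E : Type*} [NormedAddCommGroup E] [NormedSpace ℝ E]
    (μ : ∀ i, Measure (X i)) [∀ i, SigmaFinite (μ i)] (i₀ : ι) (F : (∀ i, X i) → E) (hF : StronglyMeasurable F) :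
    StronglyMeasurable fun x : X i₀ =>
      ∫ o, F ((MeasurableEquiv.piEquivPiSubtypeProd X (· = i₀)).symm ((MeasurableEquiv.piUnique fun i : {i // i = i₀} => X i.1).symm x, o))
        ∂(Measure.pi fun i : {i // ¬ i = i₀} => μ i.1) := by
  have hG : StronglyMeasurable fun q : (∀ i : {i // i = i₀}, X i.1) × (∀ i : {i // ¬ i = i₀}, X i.1) =>
      F ((MeasurableEquiv.piEquivPiSubtypeProd X (· = i₀)).symm q) :=
    hF.comp_measurable (MeasurableEquiv.measurable _)
  have hs := hG.integral_prod_right' (ν := Measure.pi fun i : {i // ¬ i = i₀} => μ i.1)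
  exact hs.comp_measurable (MeasurableEquiv.measurable _)

/-- **The push-forward case**: for `ν = φ_* ν₀` with `φ` measurable and `F` strongly measurable and integrable,
`∫ F ∂⊗(μ[i₀ ↦ φ_* ν₀]) = ∫ k ∂ν₀, ∫ o ∂⊗_{i ≠ i₀} μ_i, F(e⁻¹(φ k, o))` (in (S-c): `φ` = conjugation of a regular torus point, `ν₀` = Haar — an orbit measure).
[cite: DeitmarEchterhoff2014, Thm. 1.5.3] [cite: Rogawski1990, §8.3 p. 122] -/
theorem integral_pi_update_map {E : Type*} [NormedAddCommGroup E] [NormedSpace ℝ E]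
    (μ : ∀ i, Measure (X i)) [∀ i, SigmaFinite (μ i)] (i₀ : ι) {Y : Type*} [MeasurableSpace Y] (ν₀ : Measure Y) {φ : Y → X i₀} (hφ : Measurable φ)
    [SigmaFinite (ν₀.map φ)] (F : (∀ i, X i) → E) (hFm : StronglyMeasurable F) (hF : Integrable F (Measure.pi (Function.update μ i₀ (ν₀.map φ)))) :
    ∫ y, F y ∂(Measure.pi (Function.update μ i₀ (ν₀.map φ))) =
      ∫ k, ∫ o, F ((MeasurableEquiv.piEquivPiSubtypeProd X (· = i₀)).symm ((MeasurableEquiv.piUnique fun i : {i // i = i₀} => X i.1).symm (φ k), o))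
        ∂(Measure.pi fun i : {i // ¬ i = i₀} => μ i.1) ∂ν₀ := by
  rw [integral_pi_update_eq_integral_integral μ i₀ (ν₀.map φ) F hF,
    integral_map hφ.aemeasurable (stronglyMeasurable_integral_assemble μ i₀ F hFm).aestronglyMeasurable]

/-- **Integrability against an updated Radon family** for continuous compactly supported `F` (the test functions of the descent). [cite: BorelJacquet1979, §4.1] -/
theorem integrable_pi_update_of_hasCompactSupport {E : Type*} [NormedAddCommGroup E] [∀ i, TopologicalSpace (X i)] [∀ i, OpensMeasurableSpace (X i)]
    [∀ i, SecondCountableTopology (X i)]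
    (μ : ∀ i, Measure (X i)) [∀ i, SigmaFinite (μ i)] [∀ i, IsFiniteMeasureOnCompacts (μ i)] (i₀ : ι) (ν : Measure (X i₀)) [SigmaFinite ν] [IsFiniteMeasureOnCompacts ν]
    (F : (∀ i, X i) → E) (hFc : Continuous F) (hFs : HasCompactSupport F) :
    Integrable F (Measure.pi (Function.update μ i₀ ν)) := by
  haveI : ∀ i, SigmaFinite (Function.update μ i₀ ν i) := sigmaFinite_update μ i₀ ν
  haveI : ∀ i, IsFiniteMeasureOnCompacts (Function.update μ i₀ ν i) := isFiniteMeasureOnCompacts_update μ i₀ ν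
  exact hFc.integrable_of_hasCompactSupport hFs

end Generic

/-! ## §2 The `archLocal` dress: ★ (R1-a)'s assembled family, Dirac masses at central places, orbit measures at regular places -/

section Arch

variable (L : Type) [Field L] [NumberField L] (N : ℕ) (α : Fin N → L)
  [∀ w : {w : InfinitePlace L // IsComplex w}, MeasurableSpace (archLocal L N (Matrix.diagonal α) w)]

open scoped Classical in
/-- **One place in, one place out, on `∏_w G_w`** (`G_w = archLocal L N (diag α) w`): §1 with ★ (R1-a)'s binders. [cite: BorelJacquet1979, §4.1] [cite: Rogawski1990, §8.3 p. 122] -/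
theorem integral_pi_update_eq_integral_integral_archLocal {E : Type*} [NormedAddCommGroup E] [NormedSpace ℝ E]
    (μ : ∀ w : {w : InfinitePlace L // IsComplex w}, Measure (archLocal L N (Matrix.diagonal α) w)) [∀ w, SigmaFinite (μ w)]
    (w₀ : {w : InfinitePlace L // IsComplex w}) (ν : Measure (archLocal L N (Matrix.diagonal α) w₀)) [SigmaFinite ν]
    (F : (∀ w : {w : InfinitePlace L // IsComplex w}, archLocal L N (Matrix.diagonal α) w) → E) (hF : Integrable F (Measure.pi (Function.update μ w₀ ν))) :
    ∫ y, F y ∂(Measure.pi (Function.update μ w₀ ν)) =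
      ∫ x, ∫ o : (∀ w' : {w : {w : InfinitePlace L // IsComplex w} // ¬ w = w₀}, archLocal L N (Matrix.diagonal α) w'.1),
        F ((MeasurableEquiv.piEquivPiSubtypeProd (fun w : {w : InfinitePlace L // IsComplex w} => ↥(archLocal L N (Matrix.diagonal α) w)) (· = w₀)).symm
          ((MeasurableEquiv.piUnique fun i : {w : {w : InfinitePlace L // IsComplex w} // w = w₀} => ↥(archLocal L N (Matrix.diagonal α) i.1)).symm x, o))
        ∂(Measure.pi fun w' : {w : {w : InfinitePlace L // IsComplex w} // ¬ w = w₀} => μ w'.1) ∂ν :=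
  integral_pi_update_eq_integral_integral μ w₀ ν F hF

open scoped Classical in
/-- **A central place is a Dirac coordinate**: `∫ F ∂⊗(μ[w₀ ↦ δ_{x₀}]) = ∫ o, F(e⁻¹(x₀, o)) ∂⊗_{w′≠w₀} μ_{w′}` — the shape of the LIMIT VALUE in ★ `exists_tendsto_deriv_two_sin_smul_integral_integral_insert`
(`x₀ = diag(z, z)`), read back as a full-family integral. [cite: Rogawski1990, §14.5 p. 238] [cite: BorelJacquet1979, §4.1] -/
theorem integral_pi_update_dirac_archLocal {E : Type*} [NormedAddCommGroup E] [NormedSpace ℝ E] [CompleteSpace E]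
    [∀ w : {w : InfinitePlace L // IsComplex w}, BorelSpace (archLocal L N (Matrix.diagonal α) w)]
    (μ : ∀ w : {w : InfinitePlace L // IsComplex w}, Measure (archLocal L N (Matrix.diagonal α) w)) [∀ w, SigmaFinite (μ w)]
    (w₀ : {w : InfinitePlace L // IsComplex w}) (x₀ : archLocal L N (Matrix.diagonal α) w₀)
    (F : (∀ w : {w : InfinitePlace L // IsComplex w}, archLocal L N (Matrix.diagonal α) w) → E)
    (hF : Integrable F (Measure.pi (Function.update μ w₀ (Measure.dirac x₀)))) :
    ∫ y, F y ∂(Measure.pi (Function.update μ w₀ (Measure.dirac x₀))) =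
      ∫ o : (∀ w' : {w : {w : InfinitePlace L // IsComplex w} // ¬ w = w₀}, archLocal L N (Matrix.diagonal α) w'.1),
        F ((MeasurableEquiv.piEquivPiSubtypeProd (fun w : {w : InfinitePlace L // IsComplex w} => ↥(archLocal L N (Matrix.diagonal α) w)) (· = w₀)).symm
          ((MeasurableEquiv.piUnique fun i : {w : {w : InfinitePlace L // IsComplex w} // w = w₀} => ↥(archLocal L N (Matrix.diagonal α) i.1)).symm x₀, o))
        ∂(Measure.pi fun w' : {w : {w : InfinitePlace L // IsComplex w} // ¬ w = w₀} => μ w'.1) :=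
  integral_pi_update_dirac μ w₀ x₀ F hF

open scoped Classical in
/-- **A regular place is an orbit-measure coordinate**: for the orbit measure `conj(diag u)_* ν₀` at `w₀` (★ `isFiniteMeasureOnCompacts_map_conj_circleDiagonal` makes it Radon when `u` is regular),
`∫ F ∂⊗(μ[w₀ ↦ conj(diag u)_* ν₀]) = ∫ k ∂ν₀, ∫ o ∂⊗_{w′≠w₀} μ_{w′}, F(e⁻¹(k·diag(u)·k⁻¹, o))` — the INTEGRAND of ★ `exists_tendsto_deriv_two_sin_smul_integral_integral_insert` (`N = 2`,
`u = (z e^{iψ}, z e^{−iψ})`, `ν₀` Haar). [cite: Rogawski1990, §8.3 p. 122; §14.5 p. 238] [cite: BorelJacquet1979, §4.1] -/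
theorem integral_pi_update_map_conj_circleDiagonal_archLocal {E : Type*} [NormedAddCommGroup E] [NormedSpace ℝ E]
    [∀ w : {w : InfinitePlace L // IsComplex w}, BorelSpace (archLocal L N (Matrix.diagonal α) w)]
    (μ : ∀ w : {w : InfinitePlace L // IsComplex w}, Measure (archLocal L N (Matrix.diagonal α) w)) [∀ w, SigmaFinite (μ w)]
    (w₀ : {w : InfinitePlace L // IsComplex w}) (u : Fin N → Circle) (ν₀ : Measure (archLocal L N (Matrix.diagonal α) w₀))
    [SigmaFinite (ν₀.map fun g : archLocal L N (Matrix.diagonal α) w₀ => g * ⟨circleDiagonal N u, circleDiagonal_mem_archLocal_diagonal L N α w₀ u⟩ * g⁻¹)]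
    (F : (∀ w : {w : InfinitePlace L // IsComplex w}, archLocal L N (Matrix.diagonal α) w) → E) (hFm : StronglyMeasurable F)
    (hF : Integrable F (Measure.pi (Function.update μ w₀
      (ν₀.map fun g : archLocal L N (Matrix.diagonal α) w₀ => g * ⟨circleDiagonal N u, circleDiagonal_mem_archLocal_diagonal L N α w₀ u⟩ * g⁻¹)))) :
    ∫ y, F y ∂(Measure.pi (Function.update μ w₀
        (ν₀.map fun g : archLocal L N (Matrix.diagonal α) w₀ => g * ⟨circleDiagonal N u, circleDiagonal_mem_archLocal_diagonal L N α w₀ u⟩ * g⁻¹))) =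
      ∫ k, ∫ o : (∀ w' : {w : {w : InfinitePlace L // IsComplex w} // ¬ w = w₀}, archLocal L N (Matrix.diagonal α) w'.1),
        F ((MeasurableEquiv.piEquivPiSubtypeProd (fun w : {w : InfinitePlace L // IsComplex w} => ↥(archLocal L N (Matrix.diagonal α) w)) (· = w₀)).symm
          ((MeasurableEquiv.piUnique fun i : {w : {w : InfinitePlace L // IsComplex w} // w = w₀} => ↥(archLocal L N (Matrix.diagonal α) i.1)).symm
            (k * ⟨circleDiagonal N u, circleDiagonal_mem_archLocal_diagonal L N α w₀ u⟩ * k⁻¹), o))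
        ∂(Measure.pi fun w' : {w : {w : InfinitePlace L // IsComplex w} // ¬ w = w₀} => μ w'.1) ∂ν₀ :=
  integral_pi_update_map μ w₀ ν₀ (measurable_conj_circleDiagonal L N α w₀ u) F hFm hF

end Arch

end Literature.NumberTheory.Automorphic.UnitaryGroup

end
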